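import Literature.Barriers.CriticalPhenomena.FKParafermionicHalfCauchyRiemann

noncomputable section

namespace Summit.CriticalPhenomena.CardyFormulaZ2.Theorems.WeakHolomorphy.SplitBypass

open scoped BigOperators
open _root_.Literature.Probability.LatticeModels
open _root_.Literature.Barriers.CriticalPhenomena (medialCornersAt medialVertexOf halfCRForm HalfCRRelationAt)
open _root_.Literature.Barriers.CriticalPhenomena.HalfCRGreen (coeff twin)

/-!
# Stub `stub_taylorComb` of the line `Sketch` (crux `CardySusyWard.WeakHolomorphy`,
# stmt-CriticalPhenomena-11292): the per-corner second-order Taylor cancellation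

For a medial vertex `p = (x, i)` of `δℤ²` with point `z_p = medialPoint δ (medialVertexOf p)` and
its `k`-th corner (clockwise `NW, NE, SE, SW`), the other medial vertex of that corner is
`twin x i k`, and `z_p - z_twin = (δ/2)·u_k` with `u = (1 - i, -1 - i, -1 + i, 1 + i)` (the same
table for `i = 0` and `i = 1`).  Writing `z_p = m + v`, `z_twin = m - v` (`v = (δ/4)·u_k`,
`‖v‖ = δ/(2√2)`), the symmetrised weight
`w(p,k) + w(twin p k, k+2)`, `w(p,k) = ∂̄φ(z_p) + i(−1)^{k+1}∂φ(z_p) − (2(1−i)/δ)·coeff i k·φ(z_p)`,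
equals (by `coeff i (k+2) = -coeff i k` and the parity of `k + 2`)
`[∂̄φ(m+v) + ∂̄φ(m−v)] + i(−1)^{k+1}[∂φ(m+v) + ∂φ(m−v)] − (2(1−i)/δ)·coeff i k·[φ(m+v) − φ(m−v)]`;
the symmetric second-order Taylor toolkit (a hypothesis here) turns the three brackets into
`2·(value at m) + O(C‖v‖²)` resp. `2 Dφ(m)v + O(C‖v‖³)`, and the midpoint terms cancel EXACTLY
because `(1 − i)·coeff i k·Re u_k = 1 + i(−1)^{k+1}` and `(1 − i)·coeff i k·Im u_k = i + (−1)^{k+1}`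
for all four `k` (`taylorComb_cancel_re/im`).  What is left is `O(C δ²)` with constant `1`.
-/

open Complex in
/-- The antipodal corner index `k + 2` has the parity of `k`: the sign `(−1)^{(k+2)+1}` of the
twin's weight equals `(−1)^{k+1}`. [folklore] -/
theorem taylorComb_neg_one_pow (k : Fin 4) :
    ((-1 : ℂ) ^ ((k + 2 : Fin 4).val + 1)) = (-1) ^ (k.val + 1) := by
  have h : ((-1 : ℤ) ^ ((k + 2 : Fin 4).val + 1)) = (-1) ^ (k.val + 1) := by
    revert k; decide
  exact_mod_cast congrArg (Int.cast : ℤ → ℂ) h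

open Complex in
/-- The sign `(−1)^{k+1}` has norm one. [folklore] -/
theorem taylorComb_norm_sign (k : Fin 4) : ‖((-1 : ℂ) ^ (k.val + 1))‖ = 1 := by
  simp [norm_pow]

open Complex in
/-- The half-CR coefficients `coeff i k ∈ {1, -i, -1, i}` have norm one. [folklore] -/
theorem taylorComb_norm_coeff (k : Fin 4) : ‖coeff Complex.I k‖ = 1 := by
  fin_cases k <;> simp [coeff]

/-- `|Re u_k| = 1`. [folklore] -/
theorem taylorComb_abs_re (k : Fin 4) : |(![1, -1, -1, 1] : Fin 4 → ℝ) k| = 1 := by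
  fin_cases k <;> simp

/-- `|Im u_k| = 1`. [folklore] -/
theorem taylorComb_abs_im (k : Fin 4) : |(![-1, -1, 1, 1] : Fin 4 → ℝ) k| = 1 := by
  fin_cases k <;> simp

open Complex in
/-- **Exact cancellation of the midpoint terms, real direction**:
`(1 − i)·coeff i k·Re u_k = 1 + i(−1)^{k+1}` for the four corners. [folklore] -/
theorem taylorComb_cancel_re (k : Fin 4) :
    (1 - I) * coeff I k * ((![1, -1, -1, 1] : Fin 4 → ℝ) k : ℂ) =
      1 + I * (-1) ^ (k.val + 1) := by
  fin_cases k <;> apply Complex.ext <;> norm_num [coeff]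

open Complex in
/-- **Exact cancellation of the midpoint terms, imaginary direction**:
`(1 − i)·coeff i k·Im u_k = i + (−1)^{k+1}` for the four corners. [folklore] -/
theorem taylorComb_cancel_im (k : Fin 4) :
    (1 - I) * coeff I k * ((![-1, -1, 1, 1] : Fin 4 → ℝ) k : ℂ) =
      I + (-1) ^ (k.val + 1) := by
  fin_cases k <;> apply Complex.ext <;> norm_num [coeff]

open Complex in
/-- The `∂̄`-type coefficient `(1 + i s)/2`, `‖s‖ = 1`, has norm at most one. [folklore] -/
theorem taylorComb_norm_Tb (s : ℂ) (hs : ‖s‖ = 1) : ‖(1 + I * s) / 2‖ ≤ 1 := by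
  rw [norm_div]
  have h : ‖1 + I * s‖ ≤ 2 := by
    calc ‖1 + I * s‖ ≤ ‖(1 : ℂ)‖ + ‖I * s‖ := norm_add_le _ _
      _ = 2 := by rw [norm_mul, norm_I, hs]; norm_num
  have h2 : ‖(2 : ℂ)‖ = 2 := by simp
  rw [h2]
  linarith

open Complex in
/-- The `∂`-type coefficient `(i + s)/2`, `‖s‖ = 1`, has norm at most one. [folklore] -/
theorem taylorComb_norm_Tc (s : ℂ) (hs : ‖s‖ = 1) : ‖(I + s) / 2‖ ≤ 1 := by
  rw [norm_div]
  have h : ‖I + s‖ ≤ 2 := by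
    calc ‖I + s‖ ≤ ‖I‖ + ‖s‖ := norm_add_le _ _
      _ = 2 := by rw [norm_I, hs]; norm_num
  have h2 : ‖(2 : ℂ)‖ = 2 := by simp
  rw [h2]
  linarith

open Complex in
/-- The value coefficient `2(1 − i)·c/δ`, `‖c‖ = 1`, has norm at most `4/δ`. [folklore] -/
theorem taylorComb_norm_Ta {δ : ℝ} (hδ : 0 < δ) (c : ℂ) (hc : ‖c‖ = 1) :
    ‖2 * (1 - I) / (δ : ℂ) * c‖ ≤ 4 / δ := by
  have h1 : ‖(1 : ℂ) - I‖ ≤ 2 := by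
    calc ‖(1 : ℂ) - I‖ ≤ ‖(1 : ℂ)‖ + ‖I‖ := norm_sub_le _ _
      _ = 2 := by rw [norm_I]; norm_num
  rw [norm_mul, norm_div, norm_mul, hc, Complex.norm_real, Real.norm_of_nonneg hδ.le]
  have h2 : ‖(2 : ℂ)‖ = 2 := by simp
  rw [h2, mul_one, div_le_div_iff_of_pos_right hδ]
  linarith

/-- **The three-term estimate.** If `‖T_b‖, ‖T_c‖ ≤ 1`, `‖T_a‖ ≤ 4/δ` and the three Taylor
remainders are `≤ C r²`, `≤ C r²`, `≤ C r³` with `0 ≤ r ≤ δ/2`, `0 ≤ C`, then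
`‖T_b E_b + T_c E_c − T_a E_a‖ ≤ C δ²` (`= C δ²/4 + C δ²/4 + C δ²/2`). [folklore] -/
theorem taylorComb_three_terms {C r δ : ℝ} (hC : 0 ≤ C) (hδ : 0 < δ) (hr0 : 0 ≤ r)
    (hr : r ≤ δ / 2) {Tb Tc Ta Eb Ec Ea : ℂ} (hTb : ‖Tb‖ ≤ 1) (hTc : ‖Tc‖ ≤ 1)
    (hTa : ‖Ta‖ ≤ 4 / δ) (hEb : ‖Eb‖ ≤ C * r ^ 2) (hEc : ‖Ec‖ ≤ C * r ^ 2)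
    (hEa : ‖Ea‖ ≤ C * r ^ 3) :
    ‖Tb * Eb + Tc * Ec - Ta * Ea‖ ≤ 1 * C * δ ^ 2 := by
  have hr2 : r ^ 2 ≤ (δ / 2) ^ 2 := pow_le_pow_left₀ hr0 hr 2
  have hr3 : r ^ 3 ≤ (δ / 2) ^ 3 := pow_le_pow_left₀ hr0 hr 3
  have h4 : (0 : ℝ) ≤ 4 / δ := by positivity
  calc ‖Tb * Eb + Tc * Ec - Ta * Ea‖ ≤ ‖Tb * Eb + Tc * Ec‖ + ‖Ta * Ea‖ := norm_sub_le _ _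
    _ ≤ ‖Tb * Eb‖ + ‖Tc * Ec‖ + ‖Ta * Ea‖ := by gcongr; exact norm_add_le _ _
    _ = ‖Tb‖ * ‖Eb‖ + ‖Tc‖ * ‖Ec‖ + ‖Ta‖ * ‖Ea‖ := by simp only [norm_mul]
    _ ≤ 1 * (C * r ^ 2) + 1 * (C * r ^ 2) + 4 / δ * (C * r ^ 3) :=
        add_le_add (add_le_add (mul_le_mul hTb hEb (norm_nonneg _) zero_le_one)
          (mul_le_mul hTc hEc (norm_nonneg _) zero_le_one))
          (mul_le_mul hTa hEa (norm_nonneg _) h4)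
    _ ≤ 1 * (C * (δ / 2) ^ 2) + 1 * (C * (δ / 2) ^ 2) + 4 / δ * (C * (δ / 2) ^ 3) :=
        add_le_add (add_le_add (by rw [one_mul, one_mul]; exact mul_le_mul_of_nonneg_left hr2 hC)
          (by rw [one_mul, one_mul]; exact mul_le_mul_of_nonneg_left hr2 hC))
          (mul_le_mul_of_nonneg_left (mul_le_mul_of_nonneg_left hr3 hC) h4)
    _ = 1 * C * δ ^ 2 := by field_simp; ring

open Complex in
/-- **Core of `stub_taylorComb` (midpoint form).** If two points satisfy
`z_p − z_t = (δ/2)·u_k`, then they are `≤ δ` apart and, under the symmetric second-order Taylor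
toolkit with constant `C`, the symmetrised corner weight `w(z_p, k) + w(z_t, k + 2)` has norm
`≤ C δ²`: write `z_p = m + v`, `z_t = m − v`, expand `Dφ(m)v = Re v·φ_x(m) + Im v·φ_y(m)` by
`ℝ`-linearity, cancel the midpoint terms exactly (`taylorComb_cancel_re/im`) and estimate the three
Taylor remainders (`taylorComb_three_terms`, `‖v‖ ≤ |Re v| + |Im v| = δ/2`). [folklore] -/
theorem taylorComb_core {φ : ℂ → ℂ} {C δ : ℝ} (hδ : 0 < δ) (hδ1 : δ ≤ 1)
    (hT : ∀ (m v : ℂ), ‖v‖ ≤ 1 →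
      ‖φ (m + v) - φ (m - v) - 2 * fderiv ℝ φ m v‖ ≤ C * ‖v‖ ^ 3 ∧
      ‖fderiv ℝ φ (m + v) 1 + fderiv ℝ φ (m - v) 1 - 2 * fderiv ℝ φ m 1‖ ≤ C * ‖v‖ ^ 2 ∧
      ‖fderiv ℝ φ (m + v) Complex.I + fderiv ℝ φ (m - v) Complex.I - 2 * fderiv ℝ φ m Complex.I‖
        ≤ C * ‖v‖ ^ 2)
    (k : Fin 4) (zp zt : ℂ)
    (hd : zp - zt = (δ / 2 : ℂ) *
      (((![1, -1, -1, 1] : Fin 4 → ℝ) k : ℂ) + ((![-1, -1, 1, 1] : Fin 4 → ℝ) k : ℂ) * Complex.I)) :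
    dist zp zt ≤ δ ∧
    ‖((fderiv ℝ φ zp 1 + Complex.I * fderiv ℝ φ zp Complex.I) / 2 +
          Complex.I * (-1) ^ (k.val + 1) *
            ((fderiv ℝ φ zp 1 - Complex.I * fderiv ℝ φ zp Complex.I) / 2) -
          2 * (1 - Complex.I) / δ * coeff Complex.I k * φ zp) +
        ((fderiv ℝ φ zt 1 + Complex.I * fderiv ℝ φ zt Complex.I) / 2 +
          Complex.I * (-1) ^ ((k + 2 : Fin 4).val + 1) *
            ((fderiv ℝ φ zt 1 - Complex.I * fderiv ℝ φ zt Complex.I) / 2) -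
          2 * (1 - Complex.I) / δ * coeff Complex.I (k + 2) * φ zt)‖ ≤ 1 * C * δ ^ 2 := by
  -- the toolkit forces `0 ≤ C` (take `v = 1`)
  have hC : 0 ≤ C := by
    have h := (hT 0 1 (by simp)).2.1
    have h' : (0 : ℝ) ≤ C * ‖(1 : ℂ)‖ ^ 2 := (norm_nonneg _).trans h
    simpa using h'
  have hδc : (δ : ℂ) ≠ 0 := Complex.ofReal_ne_zero.mpr hδ.ne'
  -- the half-difference `v = a + b i`, `a = (δ/4) Re u_k`, `b = (δ/4) Im u_k`
  set a : ℝ := δ / 4 * (![1, -1, -1, 1] : Fin 4 → ℝ) k with ha_def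
  set b : ℝ := δ / 4 * (![-1, -1, 1, 1] : Fin 4 → ℝ) k with hb_def
  have ha : |a| = δ / 4 := by
    rw [ha_def, abs_mul, taylorComb_abs_re, mul_one, abs_of_pos (by positivity)]
  have hb : |b| = δ / 4 := by
    rw [hb_def, abs_mul, taylorComb_abs_im, mul_one, abs_of_pos (by positivity)]
  -- the two exact cancellations, rescaled by `δ/4`
  have h1 : 2 * (1 - I) / (δ : ℂ) * coeff I k * (a : ℂ) = (1 + I * (-1) ^ (k.val + 1)) / 2 := by
    rw [← taylorComb_cancel_re k, ha_def]
    push_cast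
    field_simp
    ring
  have h2 : 2 * (1 - I) / (δ : ℂ) * coeff I k * (b : ℂ) = (I + (-1) ^ (k.val + 1)) / 2 := by
    rw [← taylorComb_cancel_im k, hb_def]
    push_cast
    field_simp
    ring
  have hd' : zp - zt = 2 * ((a : ℂ) + (b : ℂ) * I) := by
    rw [hd, ha_def, hb_def]; push_cast; ring
  -- `‖v‖ ≤ |a| + |b| = δ/2 ≤ 1`
  have hv : ‖(a : ℂ) + (b : ℂ) * I‖ ≤ δ / 2 := by
    refine (Complex.norm_le_abs_re_add_abs_im _).trans ?_
    have hre : ((a : ℂ) + (b : ℂ) * I).re = a := by simp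
    have him : ((a : ℂ) + (b : ℂ) * I).im = b := by simp
    rw [hre, him, ha, hb]
    linarith
  have hv1 : ‖(a : ℂ) + (b : ℂ) * I‖ ≤ 1 := hv.trans (by linarith)
  refine ⟨?_, ?_⟩
  · -- distance of the two medial vertices of the corner: `2‖v‖ ≤ δ`
    rw [Complex.dist_eq, hd', norm_mul]
    have h2' : ‖(2 : ℂ)‖ = 2 := by simp
    rw [h2']
    linarith
  -- pass to the midpoint `m` and half-difference `v`
  obtain ⟨m, rfl, rfl⟩ :
      ∃ m : ℂ, zp = m + ((a : ℂ) + (b : ℂ) * I) ∧ zt = m - ((a : ℂ) + (b : ℂ) * I) :=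
    ⟨zp - ((a : ℂ) + (b : ℂ) * I), by ring, by linear_combination (-1 : ℂ) * hd'⟩
  set v : ℂ := (a : ℂ) + (b : ℂ) * I with hv_def
  obtain ⟨hA, hB, hCc⟩ := hT m v hv1
  -- `ℝ`-linearity of the Fréchet derivative: `Dφ(m) v = a φ_x(m) + b φ_y(m)`
  have hD : fderiv ℝ φ m v = (a : ℂ) * fderiv ℝ φ m 1 + (b : ℂ) * fderiv ℝ φ m I := by
    have hv' : v = a • (1 : ℂ) + b • I := by
      rw [hv_def, Complex.real_smul, Complex.real_smul, mul_one]
    rw [hv', map_add, map_smul, map_smul, Complex.real_smul, Complex.real_smul]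
  -- antipodal sign and coefficient
  rw [taylorComb_neg_one_pow, _root_.Literature.Barriers.CriticalPhenomena.HalfCRGreen.coeff_add_two]
  -- exact cancellation of the midpoint terms: only the three Taylor remainders survive
  have key :
      ((fderiv ℝ φ (m + v) 1 + I * fderiv ℝ φ (m + v) I) / 2 +
          I * (-1) ^ (k.val + 1) * ((fderiv ℝ φ (m + v) 1 - I * fderiv ℝ φ (m + v) I) / 2) -
          2 * (1 - I) / δ * coeff I k * φ (m + v)) +
        ((fderiv ℝ φ (m - v) 1 + I * fderiv ℝ φ (m - v) I) / 2 +
          I * (-1) ^ (k.val + 1) * ((fderiv ℝ φ (m - v) 1 - I * fderiv ℝ φ (m - v) I) / 2) -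
          2 * (1 - I) / δ * -coeff I k * φ (m - v)) =
      (1 + I * (-1) ^ (k.val + 1)) / 2 *
          (fderiv ℝ φ (m + v) 1 + fderiv ℝ φ (m - v) 1 - 2 * fderiv ℝ φ m 1) +
        (I + (-1) ^ (k.val + 1)) / 2 *
          (fderiv ℝ φ (m + v) I + fderiv ℝ φ (m - v) I - 2 * fderiv ℝ φ m I) -
        2 * (1 - I) / δ * coeff I k * (φ (m + v) - φ (m - v) - 2 * fderiv ℝ φ m v) := by
    linear_combination (-2 * (2 * (1 - I) / (δ : ℂ) * coeff I k)) * hD +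
      (-2 * fderiv ℝ φ m 1) * h1 + (-2 * fderiv ℝ φ m I) * h2 +
      (-(-1) ^ (k.val + 1) * (fderiv ℝ φ (m + v) I + fderiv ℝ φ (m - v) I) / 2) * Complex.I_sq
  rw [key]
  exact taylorComb_three_terms hC hδ (norm_nonneg v) hv
    (taylorComb_norm_Tb _ (taylorComb_norm_sign k)) (taylorComb_norm_Tc _ (taylorComb_norm_sign k))
    (taylorComb_norm_Ta hδ _ (taylorComb_norm_coeff k)) hB hCc hA

/-- **Explicit lattice geometry of a corner.** The two medial vertices `p = (x, i)` and
`twin x i k` of the `k`-th corner at `p` sit at `z_p − z_twin = (δ/2)·u_k`,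
`u = (1 − i, −1 − i, −1 + i, 1 + i)` for `k = NW, NE, SE, SW` — the same table for horizontal
(`i = 0`) and vertical (`i = 1`) medial vertices (eight cases, from `twin`, `medialVertexOf`,
`medialPoint_mk`, `meshPoint`). [folklore] -/
theorem taylorComb_diff (δ : ℝ) (p : Site 2 × Fin 2) (k : Fin 4) :
    medialPoint δ (medialVertexOf p) - medialPoint δ (medialVertexOf (twin p.1 p.2 k)) =
      (δ / 2 : ℂ) *
        (((![1, -1, -1, 1] : Fin 4 → ℝ) k : ℂ) + ((![-1, -1, 1, 1] : Fin 4 → ℝ) k : ℂ) * Complex.I) := by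
  obtain ⟨x, i⟩ := p
  apply Complex.ext
  · simp only [medialVertexOf, medialPoint_mk, Complex.sub_re, Complex.div_ofNat_re, Complex.add_re,
      meshPoint_re, Pi.add_apply]
    fin_cases i <;> fin_cases k <;> simp [twin] <;> ring
  · simp only [medialVertexOf, medialPoint_mk, Complex.sub_im, Complex.div_ofNat_im, Complex.add_im,
      meshPoint_im, Pi.add_apply]
    fin_cases i <;> fin_cases k <;> simp [twin] <;> ring

/-- **`stub_taylorComb` — per-corner second-order cancellation (explicit lattice geometry + the
toolkit).** With `z_p = medialPoint δ (medialVertexOf p)`, `∂̄φ = (φ_x + iφ_y)/2`, `∂φ = (φ_x − iφ_y)/2`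
and the weight `w(p,k) = ∂̄φ(z_p) + i(−1)^{k+1}∂φ(z_p) − (2(1−i)/δ)·coeff i k·φ(z_p)`, the symmetrised
weight `w(p,k) + w(twin p k, k+2)` of a corner is `O(δ²)` (constant `C' = 1` times the toolkit
constant `C`: the midpoint terms cancel exactly, `taylorComb_core` + `taylorComb_diff`), and the two
medial vertices of a corner are `δ/√2 ≤ δ` apart. [folklore] -/
theorem stub_taylorComb : ∃ C' : ℝ, ∀ (φ : ℂ → ℂ) (C : ℝ),
    (∀ (m v : ℂ), ‖v‖ ≤ 1 →
      ‖φ (m + v) - φ (m - v) - 2 * fderiv ℝ φ m v‖ ≤ C * ‖v‖ ^ 3 ∧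
      ‖fderiv ℝ φ (m + v) 1 + fderiv ℝ φ (m - v) 1 - 2 * fderiv ℝ φ m 1‖ ≤ C * ‖v‖ ^ 2 ∧
      ‖fderiv ℝ φ (m + v) Complex.I + fderiv ℝ φ (m - v) Complex.I - 2 * fderiv ℝ φ m Complex.I‖
        ≤ C * ‖v‖ ^ 2) →
    ∀ (δ : ℝ), 0 < δ → δ ≤ 1 → ∀ (p : Site 2 × Fin 2) (k : Fin 4),
      dist (medialPoint δ (medialVertexOf p)) (medialPoint δ (medialVertexOf (twin p.1 p.2 k))) ≤ δ ∧
      ‖((fderiv ℝ φ (medialPoint δ (medialVertexOf p)) 1 +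
            Complex.I * fderiv ℝ φ (medialPoint δ (medialVertexOf p)) Complex.I) / 2 +
          Complex.I * (-1) ^ (k.val + 1) *
            ((fderiv ℝ φ (medialPoint δ (medialVertexOf p)) 1 -
              Complex.I * fderiv ℝ φ (medialPoint δ (medialVertexOf p)) Complex.I) / 2) -
          2 * (1 - Complex.I) / δ * coeff Complex.I k * φ (medialPoint δ (medialVertexOf p))) +
        ((fderiv ℝ φ (medialPoint δ (medialVertexOf (twin p.1 p.2 k))) 1 +
            Complex.I * fderiv ℝ φ (medialPoint δ (medialVertexOf (twin p.1 p.2 k))) Complex.I) / 2 +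
          Complex.I * (-1) ^ ((k + 2 : Fin 4).val + 1) *
            ((fderiv ℝ φ (medialPoint δ (medialVertexOf (twin p.1 p.2 k))) 1 -
              Complex.I * fderiv ℝ φ (medialPoint δ (medialVertexOf (twin p.1 p.2 k))) Complex.I) / 2) -
          2 * (1 - Complex.I) / δ * coeff Complex.I (k + 2) *
            φ (medialPoint δ (medialVertexOf (twin p.1 p.2 k))))‖ ≤ C' * C * δ ^ 2 := by
  refine ⟨1, ?_⟩
  intro φ C hT δ hδ hδ1 p k
  exact taylorComb_core hδ hδ1 hT k _ _ (taylorComb_diff δ p k)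

end Summit.CriticalPhenomena.CardyFormulaZ2.Theorems.WeakHolomorphy.SplitBypass

end
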